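import Summits.CriticalPhenomena.PercolationContinuityZ3.Theorems.PercNearOneGluingNoHeavyLowerTailQuantitativeCshDecoyInvisibility
import HarnessLib

/-!
# THE POCKET-REGIME LEVEL DECOMPOSITION of the (S5) margin: a sum of DECOY-FREE CSH margins

Support file (`--supports stmt-CriticalPhenomena-4575`), prover seat `prim-rate-mine-2` (lane prim-rate, constants-miner (c), BENCH row
M2-R39; `run/shared/lean/prim/prim-rate/prim-rate-mine-2/PROOFS.md` §P39–§P40).  No definitions, no named facts, no sorries; standard axioms.

Weights `< 1` supported on `E`; observers `o ≠ v`; a POCKET `K ∋ o` with `v ∉ K` whose `E`-exits end at `v` or at the `r`-minimal relay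
`x₁`; relays `T ∋ x₁` off `K`, injective rank `r`; decoys `D` off `K ∪ {v}`.  The peeling identity behind `CSH.s5dMargin_nonneg_of_csh`
(`CSH.surplus_erase_add`, `CSH.covD_clusterFun_eq`, Lemma R `CSH.cshMarg_cons`) reads, peeling the rank-maximal relay `k`:
`μ(A_k)·M(T; D) = μ(A_k)·M(T ∖ k; k :: D) + cshMargin w k (T ∖ k) D o v F̂_k + (Sur_k(T ∖ k) − κ_k)·μ(A_k)·Marg[c_k]`.
In the pocket geometry the last term vanishes (`CSH.avoid_pattern_ratio_of_pocket`, as in `CSH.s5dMargin_nonneg_of_pocket`) and the level margin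
does not see its decoys (`CSH.cshMargin_eq_nil_of_decoys_off_pocket` with the pocket `K`: its exits end at `v` or `x₁ ∈ T`).  Unrolling:

* `CSH.s5dMargin_eq_sum_levels_of_pocket` —
  **`s5dMargin w T r D o v F = Σ_{a ∈ T} cshMargin w a T_{<a} [] o v F̂_a / μ(a ↮ T_{<a})`**, `T_{<a} = {t ∈ T | r t < r a}`,
  `F̂_a(C) = F({a} ∪ ⋃ C)` — for EVERY functional `F` (no monotonicity, no compatibility) and every decoy list off the pocket;
* `CSH.s5dMargin_nil_eq_sum_levels_of_forall_not_adj` — the same with the canonical pocket (vertices joined to `o` by pairs of `E` missing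
  `T ∪ {v}`) under «every relay adjacent to the pocket is `x₁`», `D = []`.

Each level is a decoy-free CSH margin: `≥ 0` for monotone `F` (`CSH.cshAll_of_lt_one`) with the exact zero locus of row M2-R36
(`CSH.cshMargin_nil_pos_iff_exists_pivotal_vertexFun`) — whence the general-`F` zero set of (S5) in the pocket regime (row M2-R40).
[cite: KozmaNitzan2024, Conj. 4 (p. 32)] [cite: VandenbergHaggstromKahn2005, §2.1 (pp. 9–13)] [cite: Grimmett1999, §2.2]
-/

noncomputable section

namespace Summit.CriticalPhenomena.PercolationContinuityZ3.Theorems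

open MeasureTheory Set Literature.Probability.LatticeModels Literature.Probability.Percolation
open scoped Classical
open KNPreFKG

namespace CSH

variable {n : ℕ}

/-- **THE POCKET-REGIME LEVEL DECOMPOSITION.**  Weights `< 1` supported on `E`; `o ≠ v`; a pocket `K ∋ o` with `v ∉ K` whose `E`-exits end at
`v` or `x₁`.  For every relay set `T ∋ x₁` off `K` with `o, v ∉ T`, every injective rank `r` on `T` with `x₁` minimal, every decoy list `D` off
`K ∪ {v}` and EVERY functional `F`:
`s5dMargin w T r D o v F = Σ_{a ∈ T} cshMargin w a T_{<a} [] o v F̂_a / μ(a ↮ T_{<a})`.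
[cite: KozmaNitzan2024, Conj. 4 (p. 32)] [cite: VandenbergHaggstromKahn2005, §2.1 (pp. 9–13)] -/
theorem s5dMargin_eq_sum_levels_of_pocket (w : Sym2 (Fin n) → unitInterval) (hw : ∀ e, w e < 1) (E : Set (Sym2 (Fin n)))
    (hE0 : ∀ f, f ∉ E → (w f : ℝ) = 0) (o v x₁ : Fin n) (hov : o ≠ v) (K : Set (Fin n)) (hoK : o ∈ K) (hvK : v ∉ K)
    (hK : ∀ p q : Fin n, s(p, q) ∈ E → p ∈ K → q ∈ K ∨ q = v ∨ q = x₁) :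
    ∀ (T : Finset (Fin n)) (r : Fin n → ℕ) (D : List (Fin n)) (F : Set (Fin n) → ℝ),
      Set.InjOn r ↑T → x₁ ∈ T → (∀ t ∈ T, r x₁ ≤ r t) → o ∉ T → v ∉ T → (∀ d ∈ D, d ≠ v) → (∀ t ∈ T, t ∉ K) → (∀ d ∈ D, d ∉ K) →
      s5dMargin w T r D o v F =
        ∑ a ∈ T, cshMargin w a (↑(T.filter (fun t => r t < r a)) : Set (Fin n)) [] o v (fun C => F {c | c = a ∨ ∃ e ∈ C, c ∈ e}) /
          (prodBernoulli w).real
            {ω : BondConfig (Fin n) | ∀ t ∈ (↑(T.filter (fun t => r t < r a)) : Set (Fin n)), ¬ (openGraph ω).Reachable a t} := by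
  classical
  have _hov := hov
  -- strong induction on `|T|`
  have main : ∀ (N : ℕ) (T : Finset (Fin n)) (r : Fin n → ℕ) (D : List (Fin n)) (F : Set (Fin n) → ℝ), T.card = N →
      Set.InjOn r ↑T → x₁ ∈ T → (∀ t ∈ T, r x₁ ≤ r t) → o ∉ T → v ∉ T → (∀ d ∈ D, d ≠ v) → (∀ t ∈ T, t ∉ K) → (∀ d ∈ D, d ∉ K) →
      s5dMargin w T r D o v F =
        ∑ a ∈ T, cshMargin w a (↑(T.filter (fun t => r t < r a)) : Set (Fin n)) [] o v (fun C => F {c | c = a ∨ ∃ e ∈ C, c ∈ e}) /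
          (prodBernoulli w).real
            {ω : BondConfig (Fin n) | ∀ t ∈ (↑(T.filter (fun t => r t < r a)) : Set (Fin n)), ¬ (openGraph ω).Reachable a t} := by
    intro N
    induction N using Nat.strong_induction_on with
    | _ N ih =>
    intro T r D F hN hr hx₁T hmin hoT hvT hDv hTK hDK
    set μ := prodBernoulli w with hμ
    have hmeas : ∀ S : Set (BondConfig (Fin n)), MeasurableSet S := fun _ => MeasurableSet.of_discrete
    have hne : T.Nonempty := ⟨x₁, hx₁T⟩
    -- the rank-maximal relay `k` and `T' = T.erase k`
    obtain ⟨k, hkT, hkmax⟩ := Finset.exists_max_image T r hne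
    set T' : Finset (Fin n) := T.erase k with hT'
    have hTcard : T'.card < N := by
      have hpos : 0 < T.card := Finset.card_pos.2 hne
      rw [hT', Finset.card_erase_of_mem hkT]; omega
    have hT'T : ∀ a ∈ T', a ∈ T := fun a ha => Finset.mem_of_mem_erase ha
    have hkT' : k ∉ T' := Finset.notMem_erase k T
    have hlt : ∀ a ∈ T', r a < r k := by
      intro a ha
      rcases (hkmax a (hT'T a ha)).lt_or_eq with h | h
      · exact h
      · exact absurd (hr (hT'T a ha) hkT h) (Finset.ne_of_mem_erase ha)
    have hrT' : Set.InjOn r ↑T' := hr.mono (by intro a ha; exact hT'T a ha)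
    have hko : o ≠ k := fun h => hoT (h ▸ hkT)
    have hkv : v ≠ k := fun h => hvT (h ▸ hkT)
    have hkK : k ∉ K := hTK k hkT
    -- the rank filters: `T_{<k} = T'` and `T_{<a} = T'_{<a}` for `a ∈ T'`
    have hfk : T.filter (fun t => r t < r k) = T' := by
      ext t
      rw [Finset.mem_filter, hT', Finset.mem_erase]
      constructor
      · rintro ⟨ht, hlt'⟩
        exact ⟨fun h => lt_irrefl _ (h ▸ hlt'), ht⟩
      · rintro ⟨htk, ht⟩
        exact ⟨ht, hlt t (Finset.mem_erase.2 ⟨htk, ht⟩)⟩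
    have hfa : ∀ a ∈ T', T.filter (fun t => r t < r a) = T'.filter (fun t => r t < r a) := by
      intro a ha
      ext t
      rw [Finset.mem_filter, Finset.mem_filter, hT', Finset.mem_erase]
      constructor
      · rintro ⟨ht, hlt'⟩
        refine ⟨⟨fun h => ?_, ht⟩, hlt'⟩
        rw [h] at hlt'
        exact lt_irrefl _ ((hlt a ha).trans hlt')
      · rintro ⟨⟨_, ht⟩, hlt'⟩
        exact ⟨ht, hlt'⟩
    -- the objects
    set Dk : Set (BondConfig (Fin n)) := {ω : BondConfig (Fin n) | ∀ a ∈ (↑T' : Set (Fin n)), ¬ (openGraph ω).Reachable k a}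
      with hDk
    set mk : ℝ := ∫ ω, F (openCluster ω k) ∂μ with hmk
    set κ : ℝ := mk * μ.real Dk - ∫ ω in Dk, F (openCluster ω k) ∂μ with hκ
    set L := decoyList w (↑T : Set (Fin n)) D with hL
    set p : ℝ := obsConst w o v ((↑T : Set (Fin n)) ∪ {d | d ∈ D}) with hp
    set ck : Fin n → ℝ := avoidConst w k (↑T' : Set (Fin n)) with hck
    set Fh : Set (Sym2 (Fin n)) → ℝ := fun C => F {a | a = k ∨ ∃ e ∈ C, a ∈ e} with hFh
    set Tk : Fin n → ℝ := fun u => (∫ ω in Dk ∩ openConn k u, F (openCluster ω k) ∂μ) - μ.real (Dk ∩ openConn k u) * mk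
      with hTk
    have hempty_Dk : (∅ : BondConfig (Fin n)) ∈ Dk := by
      intro a ha h
      rw [HullPort.reachable_empty_iff] at h
      exact hkT' (h ▸ (Finset.mem_coe.1 ha))
    have hDkpos : 0 < μ.real Dk := prodBernoulli_real_pos_of_empty_mem w hw hempty_Dk
    -- set identities between the systems `(T; D)`, `(T'; k; D)` and `(T'; k :: D)`
    have hins : insert k (↑T' : Set (Fin n)) = ↑T := by
      rw [hT', Finset.coe_erase, insert_sdiff_singleton, insert_eq_of_mem (Finset.mem_coe.2 hkT)]
    have hset2 : (↑T' : Set (Fin n)) ∪ {d | d ∈ k :: D} = (↑T : Set (Fin n)) ∪ {d | d ∈ D} := by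
      ext a
      simp only [mem_union, Finset.mem_coe, hT', Finset.mem_erase, mem_setOf_eq, List.mem_cons]
      constructor
      · rintro (⟨_, ha⟩ | rfl | ha)
        · exact Or.inl ha
        · exact Or.inl hkT
        · exact Or.inr ha
      · rintro (ha | ha)
        · by_cases hak : a = k
          · exact Or.inr (Or.inl hak)
          · exact Or.inl ⟨hak, ha⟩
        · exact Or.inr (Or.inr ha)
    have hcshMargin : ∀ f : Set (Sym2 (Fin n)) → ℝ,
        cshMargin w k (↑T' : Set (Fin n)) D o v f = cshMarg L p o v (covD w k (↑T' : Set (Fin n)) f) := by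
      intro f
      rw [cshMargin, hins]
    have hnext : s5dMargin w T' r (k :: D) o v F =
        cshMarg L p o v (surplus w T' r F) - surplus w T' r F k * cshMarg L p o v ck := by
      rw [s5dMargin, hset2, decoyList, hins, cshMarg_cons]
    -- (1) Lemma P: peel `k`
    have hpeel : surplus w T r F = (surplus w T' r F) + Tk := by
      funext u
      rw [Pi.add_apply, surplus_erase_add w T r F hkT hlt u]
    -- (2) the top-relay term through `covD`
    have hTk_cov : (μ.real Dk) • Tk = covD w k (↑T' : Set (Fin n)) Fh - (κ * μ.real Dk) • ck := by
      funext u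
      simp only [Pi.smul_apply, Pi.sub_apply, smul_eq_mul]
      have h1 := covD_clusterFun_eq w T' F k u
      have h2 : μ.real (Dk ∩ openConn k u) = μ.real Dk * ck u := by
        simp only [hck, avoidConst, hDk]
        rw [mul_div_cancel₀ _ (ne_of_gt hDkpos)]
      simp only [hTk, hFh, hκ, hmk, hDk] at h1 h2 ⊢
      rw [h1, h2]
      ring
    -- (3) DECOY INVISIBILITY at the peeled level: the pocket `K` has exits `v`, `x₁ ∈ T = insert k T'`
    have h3 : cshMarg L p o v (covD w k (↑T' : Set (Fin n)) Fh) = cshMargin w k (↑T' : Set (Fin n)) [] o v Fh := by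
      rw [← hcshMargin]
      refine cshMargin_eq_nil_of_decoys_off_pocket w hw E hE0 k (↑T' : Set (Fin n)) o v K hoK hvK ?_ ?_ ?_ D hDK hDv Fh
      · intro a ha haK
        rw [hins] at ha
        exact hTK a (Finset.mem_coe.1 ha) haK
      · rw [hins]; exact fun h => hvT (Finset.mem_coe.1 h)
      · intro p' q hpq hp'
        rcases hK p' q hpq hp' with h | h | h
        · exact Or.inl h
        · exact Or.inr (Or.inl h)
        · refine Or.inr (Or.inr ?_)
          rw [hins, h]
          exact Finset.mem_coe.2 hx₁T
    -- (4) THE POCKET STEP: the rank-gain term `(Sur_k(T') − κ)·μ(Dk)·Marg[c_k]` vanishes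
    have h4 : (surplus w T' r F k - κ) * μ.real Dk * cshMarg L p o v ck = 0 := by
      by_cases hkx : k = x₁
      · -- last peel: `T' = ∅`, `Sur_k(∅) = 0 = κ`
        have hT'0 : T' = ∅ := by
          rw [Finset.eq_empty_iff_forall_notMem]
          intro a ha
          have h1 := hlt a ha
          have h2 := hmin a (hT'T a ha)
          rw [hkx] at h1
          omega
        have hs0 : surplus w T' r F k = 0 := by rw [hT'0]; simp [surplus]
        have hDk_univ : Dk = univ := by
          ext ω; simp only [hDk, hT'0, Finset.coe_empty, mem_empty_iff_false, false_implies, implies_true, mem_setOf_eq, mem_univ]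
        have hκ0 : κ = 0 := by
          simp only [hκ, hmk, hDk_univ, Measure.restrict_univ, probReal_univ, mul_one, sub_self]
        rw [hs0, hκ0, sub_self, zero_mul, zero_mul]
      · -- `k ≠ x₁`: every constant compares the observers with the ratio `p`, so `Marg[c_k] = 0`
        have hx₁T' : x₁ ∈ T' := Finset.mem_erase.2 ⟨fun h => hkx h.symm, hx₁T⟩
        set W : Finset (Fin n) := T ∪ D.toFinset with hW
        have hWset : (↑W : Set (Fin n)) = (↑T : Set (Fin n)) ∪ {d | d ∈ D} := by
          ext t; simp [hW]
        have hWK : ∀ t ∈ W, t ∉ K := by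
          intro t ht
          rcases Finset.mem_union.1 ht with ht | ht
          · exact hTK t ht
          · exact hDK t (List.mem_toFinset.1 ht)
        have hvW : v ∉ W := by
          intro h
          rcases Finset.mem_union.1 h with h | h
          · exact hvT h
          · exact hDv v (List.mem_toFinset.1 h) rfl
        set PW : Set (BondConfig (Fin n)) := {ω : BondConfig (Fin n) | ∀ t ∈ W, ¬ (openGraph ω).Reachable v t} with hPW
        have hPWeq : {ω : BondConfig (Fin n) | ∀ a ∈ (↑T : Set (Fin n)) ∪ {d | d ∈ D}, ¬ (openGraph ω).Reachable v a} = PW := by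
          ext ω; simp only [hPW, ← hWset, Finset.mem_coe, mem_setOf_eq]
        have hPWpos : 0 < μ.real PW := by
          refine prodBernoulli_real_pos_of_empty_mem w hw (C := PW) fun t ht h => ?_
          rw [HullPort.reachable_empty_iff] at h
          exact hvW (h ▸ ht)
        have hp' : p = μ.real (PW ∩ openConn o v) / μ.real PW := by
          simp only [hp, obsConst, hPWeq, hμ]
        have hratio : ∀ (A : Set (Fin n)), x₁ ∈ A → A ⊆ ↑W → ∀ d ∈ W, avoidConst w d A o = p * avoidConst w d A v := by
          intro A hxA hAW d hdW
          by_cases hdA : d ∈ A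
          · have h0 : {ω : BondConfig (Fin n) | ∀ a ∈ A, ¬ (openGraph ω).Reachable d a} = ∅ :=
              Set.eq_empty_iff_forall_notMem.2 fun ω hω => hω d hdA (SimpleGraph.Reachable.refl _)
            simp only [avoidConst, h0, empty_inter, measureReal_empty, div_zero, mul_zero]
          · have key := avoid_pattern_ratio_of_pocket w E hE0 K o v x₁ hoK hvK hK W hWK hvW A hxA hAW d hdW hdA
            rw [← hμ] at key
            simp only [avoidConst]
            by_cases hden : μ.real {ω : BondConfig (Fin n) | ∀ a ∈ A, ¬ (openGraph ω).Reachable d a} = 0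
            · have hnum0 : ∀ S : Set (BondConfig (Fin n)),
                  μ.real ({ω : BondConfig (Fin n) | ∀ a ∈ A, ¬ (openGraph ω).Reachable d a} ∩ S) = 0 := fun S =>
                le_antisymm (hden ▸ measureReal_mono inter_subset_left) measureReal_nonneg
              rw [hnum0, hnum0, zero_div, mul_zero]
            · rw [hp', div_mul_div_comm, div_eq_div_iff hden (mul_ne_zero hPWpos.ne' hden)]
              calc μ.real ({ω : BondConfig (Fin n) | ∀ a ∈ A, ¬ (openGraph ω).Reachable d a} ∩ openConn d o) *
                    (μ.real PW * μ.real {ω : BondConfig (Fin n) | ∀ a ∈ A, ¬ (openGraph ω).Reachable d a})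
                  = (μ.real PW * μ.real ({ω : BondConfig (Fin n) | ∀ a ∈ A, ¬ (openGraph ω).Reachable d a} ∩ openConn d o)) *
                      μ.real {ω : BondConfig (Fin n) | ∀ a ∈ A, ¬ (openGraph ω).Reachable d a} := by ring
                _ = (μ.real (PW ∩ openConn o v) *
                      μ.real ({ω : BondConfig (Fin n) | ∀ a ∈ A, ¬ (openGraph ω).Reachable d a} ∩ openConn d v)) *
                      μ.real {ω : BondConfig (Fin n) | ∀ a ∈ A, ¬ (openGraph ω).Reachable d a} := by rw [key]
        have hck_ratio : ck o = p * ck v :=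
          hratio (↑T' : Set (Fin n)) (Finset.mem_coe.2 hx₁T') (fun t ht => by
            rw [Finset.mem_coe, hW, Finset.mem_union]; exact Or.inl (hT'T t (Finset.mem_coe.1 ht))) k
            (by rw [hW, Finset.mem_union]; exact Or.inl hkT)
        have hL_ratio : ∀ dc ∈ L, dc.2 o = p * dc.2 v := by
          refine decoyList_forall w (fun c => c o = p * c v) (↑T : Set (Fin n)) D ?_
          intro A' hA' hA'' d hd
          refine hratio A' (hA' (Finset.mem_coe.2 hx₁T)) (fun t ht => ?_) d ?_
          · rw [Finset.mem_coe, hW, Finset.mem_union, List.mem_toFinset]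
            rcases hA'' ht with h | h
            · exact Or.inl (Finset.mem_coe.1 h)
            · exact Or.inr h
          · rw [hW, Finset.mem_union, List.mem_toFinset]; exact Or.inr hd
        rw [cshMarg_eq_zero_of_ratio L p o v hL_ratio ck hck_ratio, mul_zero]
    -- (5) the exact peeling identity and its division by `μ(Dk) > 0`
    have hmain : μ.real Dk * s5dMargin w T r D o v F =
        μ.real Dk * cshMarg L p o v (surplus w T' r F) + cshMarg L p o v (covD w k (↑T' : Set (Fin n)) Fh) -
          κ * μ.real Dk * cshMarg L p o v ck := by
      have e1 : μ.real Dk * cshMarg L p o v Tk =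
          cshMarg L p o v (covD w k (↑T' : Set (Fin n)) Fh) - κ * μ.real Dk * cshMarg L p o v ck := by
        rw [← cshMarg_smul, hTk_cov, cshMarg_sub, cshMarg_smul]
      rw [s5dMargin, ← hL, ← hp, hpeel, cshMarg_add, mul_add, e1]
      ring
    have hkey : μ.real Dk * s5dMargin w T r D o v F =
        μ.real Dk * s5dMargin w T' r (k :: D) o v F + cshMargin w k (↑T' : Set (Fin n)) [] o v Fh +
          (surplus w T' r F k - κ) * μ.real Dk * cshMarg L p o v ck := by
      rw [hmain, hnext, ← h3]
      ring
    have hstep : s5dMargin w T r D o v F =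
        s5dMargin w T' r (k :: D) o v F + cshMargin w k (↑T' : Set (Fin n)) [] o v Fh / μ.real Dk := by
      have hne' := hDkpos.ne'
      rw [h4, add_zero] at hkey
      field_simp
      linarith [hkey]
    -- (6) the `k`-th summand is the peeled level
    have hterm_k : cshMargin w k (↑(T.filter (fun t => r t < r k)) : Set (Fin n)) [] o v (fun C => F {c | c = k ∨ ∃ e ∈ C, c ∈ e}) /
        μ.real {ω : BondConfig (Fin n) | ∀ t ∈ (↑(T.filter (fun t => r t < r k)) : Set (Fin n)), ¬ (openGraph ω).Reachable k t} =
        cshMargin w k (↑T' : Set (Fin n)) [] o v Fh / μ.real Dk := by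
      rw [hfk]
    -- (7) unroll
    rw [hstep, ← Finset.add_sum_erase T _ hkT, hterm_k, ← hT', add_comm]
    congr 1
    by_cases hkx : k = x₁
    · -- last peel: `T' = ∅` and the residual margin vanishes identically
      have hT'0 : T' = ∅ := by
        rw [Finset.eq_empty_iff_forall_notMem]
        intro a ha
        have h1 := hlt a ha
        have h2 := hmin a (hT'T a ha)
        rw [hkx] at h1
        omega
      rw [hT'0, Finset.sum_empty, s5dMargin]
      have h0 : surplus w (∅ : Finset (Fin n)) r F = fun _ => 0 := by
        funext u; simp [surplus]
      rw [h0]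
      have := slForm_zero (decoyList w (↑(∅ : Finset (Fin n)) : Set (Fin n)) (k :: D))
      simp only [cshMarg]
      rw [show (fun _ : Fin n => (0 : ℝ)) = (0 : Fin n → ℝ) from rfl, this]
      simp
    · have hx₁T' : x₁ ∈ T' := Finset.mem_erase.2 ⟨fun h => hkx h.symm, hx₁T⟩
      rw [ih T'.card hTcard T' r (k :: D) F rfl hrT' hx₁T' (fun t ht => hmin t (hT'T t ht))
        (fun h => hoT (hT'T o h)) (fun h => hvT (hT'T v h))
        (fun d hd => by
          rcases List.mem_cons.1 hd with rfl | hd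
          · exact hkv.symm
          · exact hDv d hd)
        (fun t ht => hTK t (hT'T t ht))
        (fun d hd => by
          rcases List.mem_cons.1 hd with rfl | hd
          · exact hkK
          · exact hDK d hd)]
      refine Finset.sum_congr rfl fun a ha => ?_
      rw [hfa a ha]
  intro T r D F hr hx hmin hoT hvT hDv hTK hDK
  exact main T.card T r D F rfl hr hx hmin hoT hvT hDv hTK hDK

/-- **THE POCKET-REGIME LEVEL DECOMPOSITION, canonical pocket.**  Weights `< 1` supported on `E`; `o ≠ v` off `T`; `r` injective on `T` with
minimal relay `x₁ ∈ T`.  If every relay adjacent in `E` to a vertex of the observer's pocket `{y | o ⇝ y through pairs of E missing T ∪ {v}}`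
is `x₁`, then `s5dMargin w T r [] o v F = Σ_{a ∈ T} cshMargin w a T_{<a} [] o v F̂_a / μ(a ↮ T_{<a})` for every functional `F`.
[cite: KozmaNitzan2024, Conj. 4 (p. 32)] -/
theorem s5dMargin_nil_eq_sum_levels_of_forall_not_adj (w : Sym2 (Fin n) → unitInterval) (hw : ∀ e, w e < 1) (E : Set (Sym2 (Fin n)))
    (hE0 : ∀ f, f ∉ E → (w f : ℝ) = 0) (T : Finset (Fin n)) (r : Fin n → ℕ) (hr : Set.InjOn r ↑T)
    (x₁ : Fin n) (hx : x₁ ∈ T) (hmin : ∀ t ∈ T, r x₁ ≤ r t) (o v : Fin n) (hoT : o ∉ T) (hvT : v ∉ T) (hov : o ≠ v)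
    (hpocket : ∀ y b : Fin n,
      (openGraph {f | f ∈ E ∧ ∀ z ∈ f, z ∉ T ∧ z ≠ v}).Reachable o y → b ∈ T → s(y, b) ∈ E → b = x₁)
    (F : Set (Fin n) → ℝ) :
    s5dMargin w T r [] o v F =
      ∑ a ∈ T, cshMargin w a (↑(T.filter (fun t => r t < r a)) : Set (Fin n)) [] o v (fun C => F {c | c = a ∨ ∃ e ∈ C, c ∈ e}) /
        (prodBernoulli w).real
          {ω : BondConfig (Fin n) | ∀ t ∈ (↑(T.filter (fun t => r t < r a)) : Set (Fin n)), ¬ (openGraph ω).Reachable a t} := by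
  set K : Set (Fin n) := {y | (openGraph {f | f ∈ E ∧ ∀ z ∈ f, z ∉ T ∧ z ≠ v}).Reachable o y} with hKdef
  have hKprop : ∀ y ∈ K, y ∉ T ∧ y ≠ v := by
    intro y hy
    exact forall_reachable_of_edges (S := {f | f ∈ E ∧ ∀ z ∈ f, z ∉ T ∧ z ≠ v}) (fun z => z ∉ T ∧ z ≠ v) ⟨hoT, hov⟩
      (fun f hf z hz => hf.2 z hz) hy
  have hoK : o ∈ K := SimpleGraph.Reachable.refl _
  have hvK : v ∉ K := fun h => (hKprop v h).2 rfl
  have hK : ∀ p q : Fin n, s(p, q) ∈ E → p ∈ K → q ∈ K ∨ q = v ∨ q = x₁ := by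
    intro p q hpq hp
    by_cases hqv : q = v
    · exact Or.inr (Or.inl hqv)
    by_cases hqT : q ∈ T
    · exact Or.inr (Or.inr (hpocket p q hp hqT hpq))
    by_cases hpq' : p = q
    · exact Or.inl (hpq' ▸ hp)
    left
    have hadj : (openGraph {f | f ∈ E ∧ ∀ z ∈ f, z ∉ T ∧ z ≠ v}).Adj p q := by
      rw [openGraph_adj]
      refine ⟨⟨hpq, fun z hz => ?_⟩, hpq'⟩
      rcases Sym2.mem_iff.1 hz with rfl | rfl
      · exact hKprop _ hp
      · exact ⟨hqT, hqv⟩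
    exact SimpleGraph.Reachable.trans hp hadj.reachable
  exact s5dMargin_eq_sum_levels_of_pocket w hw E hE0 o v x₁ hov K hoK hvK hK T r [] F hr hx hmin hoT hvT
    (fun d hd => absurd hd List.not_mem_nil) (fun t ht htK => (hKprop t htK).1 ht) (fun d hd => absurd hd List.not_mem_nil)

end CSH

end Summit.CriticalPhenomena.PercolationContinuityZ3.Theorems

end
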